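import Summits.QuantumFields.BalabanUV.Beta.FP.SliceChainN
import Summits.QuantumFields.BalabanUV.Beta.FP.RemainderSymbolChain

/-!
# `BalabanUV.Beta.FP.RemainderSymbolChainN` — road «FP» for binder row D1, leaf H2-P of the horizontal route, sub-row H2-P-CHAIN-N (owner assignment
# 2026-08-20, R-FP-21 (B2)), PART 2: the derivative chain of the remainder symbol `B = −(A⁻¹·M)·f⁻¹` along a slice AT EVERY ORDER, against an
# ABSTRACT inverse chain `P` (`P 0 = A⁻¹`, members to be supplied by H2-P-INV-N's `invDN`) and an abstract reciprocal chain `z` (`z 0 = f⁻¹`):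
# members `bSlN P M z α β n = −Σ_{i+j=n} C(n,i)·(Σ_{k+l=i} C(i,k)·P k·M l)_{αβ}·z j`, their chain, bridges to `RemainderSymbolChain.bSl0…3`, letters.

HONEST DEPENDENCY (page 1, mandatory): continuum YM on T⁴ ⇐ BetaPertH ∧ nine spine estimates (0/9 proved); BetaPertH ⇐ (D1) ∧ (D4) ∧ CAP+tail;
G-an2-4 gates asym, D1 and NE2/3/4.  HONEST FRAMING (cell contract, verbatim): «discharging `BetaPertH` makes Bałaban's UV stability UNCONDITIONAL —
a real constructive-QFT result; it is NOT the continuum limit and NOT the Clay problem.»  THIS MODULE DISCHARGES NOTHING of the wall: [folklore] one-variable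
calculus — `FP/SliceChainN` (binomial product chains `mmN`/`ssN`, this lineage) composed twice, `HasDerivAt.neg`.
0 `def … : Prop`; nothing cited; 0 sorry; 0 wall binders; NOT D1, NOT BetaPertH, NOT continuum, NOT Clay.

ABSOLUTE RULE (cell charter, verbatim): «No internally-minted statement may enter as a cited fact. Every hypothesis is either kernel-proved in this package or a
verbatim quotation of a PUBLISHED theorem with page reference. The manuscript(s) under audit are NOT citable for their own disputed steps — they are the thing
under adjudication; programme-internal (2001/route/tribunal) claims are never citable.»

WHY.  `FP/RemainderSymbolChain` (gan24-formalise-leaf-05-g34) types the chain of `B = −(A₀⁻¹M₀)·f⁻¹` member by member to order 3 (`bSl0…3`, with the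
inverse members `X0, invD1, invD2, invD3` of `FP/InverseSymbolDeriv` and the reciprocal members `rc0…3` of `FP/SliceReciprocalChain` hard-wired).  The kernel
letters (K2)/(K3) of H2-P-KER-ASM need orders 4 and 5 (R-FP-21 (B)).  Here the inverse chain and the reciprocal chain are PARAMETERS — member families
`P : ℕ → ℝ → Matrix ι ι ℂ`, `z : ℕ → ℝ → ℂ` with pointwise chain hypotheses and geometric letters — so that H2-P-INV-N's `invDN A` (gan24-formalise-leaf-01-g47)
and any reciprocal chain of the dispersion (`iteratedDeriv j (fD q i)⁻¹`, PART 3) plug in by name; nothing of the order ≤ 3 files is rewritten, and at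
`P = (X0 A₀, invD1, invD2, invD3, …)`, `M = (M₀, …, M₃, …)`, `z = (zSl0, …, zSl3, …)` the members `0…3` below ARE `bSl0…3` (§2).

WHAT (`ι` a `Fintype` with `DecidableEq`; entry `(α, β)`; all orders `n : ℕ` free).
* §1 `uSlN P M α β n t := (mmN P M n t) α β` (the `(α,β)` entry of the `n`-th Leibniz member of `P·M`), **`bSlN P M z α β n t := −ssN (uSlN P M α β) z n t`**;
  `bSlN_zero : bSlN … 0 t = −((P 0 t * M 0 t) α β * z 0 t)`.
* §2 BRIDGES `bSlN_zero_eq_bSl0`, `bSlN_one_eq_bSl1`, `bSlN_two_eq_bSl2`, `bSlN_three_eq_bSl3`: for member families extending leaf-05-g34's order-3 data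
  (`P 0 = X0 A₀`, `P 1 = invD1 A₀ A₁`, `P 2 = invD2 …`, `P 3 = invD3 …`, `M j = M_j`, `z j = zSl_j`), `bSlN P M z α β k = bSl_k …` (`k ≤ 3`).
* §3 **`hasDerivAt_bSlN`**: entrywise chains `(P j)′ = P (j+1)`, `(M j)′ = M (j+1)` and `(z j)′ = z (j+1)` at `t` for `j ≤ n` ⟹ `(bSlN … n)′(t) = bSlN … (n+1) t`
  (also `hasDerivAt_uSlN`).
* §4 LETTERS **`norm_bSlN_le`**: `‖P j t γ δ‖ ≤ p·ρ^j`, `‖M j t γ δ‖ ≤ m·ρ^j`, `‖z j t‖ ≤ c·ρ^j` (`j ≤ n`, `0 ≤ ρ`) ⟹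
  `‖bSlN P M z α β n t‖ ≤ card ι · 4^n · (p·m·c) · ρ^n` (written `card ι * 2 ^ n * 2 ^ n * (p * m * c) * ρ ^ n`); `norm_uSlN_le`.
  With `ρ = r⁻¹` and amplitudes `p = c₀'·r^{−2}`-type (inverse Feynman symbol), `m = b·r^4·max(R,1)^N` (excess, order 4, `SliceChainN.pow_trunc_le_geometric`),
  `c = κ'·r^{−2}` (dispersion reciprocal) this is `‖∂ⁿB‖ ≤ Kₙ·r^{−n}` — the order-0 symbol letters at every order.

Provenance: binder row D1 formalisation swarm, lineage beta-d1-formalise-leaf-01, gen 8 (prover-b2b-balaban-beta-d1-formalise-leaf-01-g8-0), 2026-08-20;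
sub-row H2-P-CHAIN-N of road FP (owner b2b-balaban-beta-d1-p3); order ≤ 3 file of record: `FP/RemainderSymbolChain` (gan24-formalise-leaf-05-g34, untouched).
-/

noncomputable section

namespace Summit.QuantumFields.BalabanUV.Beta.FP.RemainderSymbolChainN

open Matrix Finset
open scoped BigOperators
open Summit.QuantumFields.BalabanUV.Beta.FP.InverseSymbolDeriv (invD1 invD2 invD3)
open Summit.QuantumFields.BalabanUV.Beta.FP.SliceChainN
open Summit.QuantumFields.BalabanUV.Beta.FP.RemainderSymbolChain (X0 uSl0 uSl1 uSl2 uSl3 zSl0 zSl1 zSl2 zSl3 bSl0 bSl1 bSl2 bSl3)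

variable {ι : Type*} [Fintype ι] [DecidableEq ι]

/-! ## §1 The members -/

section Defs

variable (P M : ℕ → ℝ → Matrix ι ι ℂ) (z : ℕ → ℝ → ℂ) (α β : ι)

/-- [our object] `uSlN n t := (mmN P M n t) α β` — the `(α,β)` entry of the `n`-th Leibniz member of `P·M`. -/
def uSlN (n : ℕ) (t : ℝ) : ℂ := mmN P M n t α β

/-- [our object] **THE REMAINDER-SYMBOL MEMBERS AT EVERY ORDER**: `bSlN n := −ssN (uSlN P M α β) z n`. -/
def bSlN (n : ℕ) (t : ℝ) : ℂ := -ssN (uSlN P M α β) z n t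

omit [DecidableEq ι] in
/-- [folklore] order zero: `bSlN … 0 t = −((P 0 t * M 0 t) α β * z 0 t)`. -/
theorem bSlN_zero (t : ℝ) : bSlN P M z α β 0 t = -((P 0 t * M 0 t) α β * z 0 t) := by
  simp [bSlN, uSlN, ssN_zero, mmN_zero]

omit [DecidableEq ι] in
/-- [folklore] the `u`-members as functions: order zero. -/
theorem uSlN_zero_eq : uSlN P M α β 0 = fun t => (P 0 t * M 0 t) α β := by
  funext t; simp [uSlN, mmN_zero]

omit [DecidableEq ι] in
/-- [folklore] … order one. -/
theorem uSlN_one_eq : uSlN P M α β 1 = fun t => SliceLeibnizChain.mm1 (P 0) (P 1) (M 0) (M 1) t α β := by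
  funext t; simp [uSlN, mmN_one]

omit [DecidableEq ι] in
/-- [folklore] … order two. -/
theorem uSlN_two_eq : uSlN P M α β 2 = fun t => SliceLeibnizChain.mm2 (P 0) (P 1) (P 2) (M 0) (M 1) (M 2) t α β := by
  funext t; simp [uSlN, mmN_two]

omit [DecidableEq ι] in
/-- [folklore] … order three. -/
theorem uSlN_three_eq : uSlN P M α β 3 = fun t => SliceLeibnizChain.mm3 (P 0) (P 1) (P 2) (P 3) (M 0) (M 1) (M 2) (M 3) t α β := by
  funext t; simp [uSlN, mmN_three]

end Defs

/-! ## §2 Bridges to the order ≤ 3 members of `FP/RemainderSymbolChain` -/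

section Bridges

variable {P M : ℕ → ℝ → Matrix ι ι ℂ} {z : ℕ → ℝ → ℂ} {A₀ A₁ A₂ A₃ M₀ M₁ M₂ M₃ : ℝ → Matrix ι ι ℂ} {f f₁ f₂ f₃ : ℝ → ℝ}
  (hP0 : P 0 = X0 A₀) (hP1 : P 1 = invD1 A₀ A₁) (hP2 : P 2 = invD2 A₀ A₁ A₂) (hP3 : P 3 = invD3 A₀ A₁ A₂ A₃)
  (hM0 : M 0 = M₀) (hM1 : M 1 = M₁) (hM2 : M 2 = M₂) (hM3 : M 3 = M₃)
  (hz0 : z 0 = zSl0 f) (hz1 : z 1 = zSl1 f f₁) (hz2 : z 2 = zSl2 f f₁ f₂) (hz3 : z 3 = zSl3 f f₁ f₂ f₃)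

include hP0 hM0 in
/-- [folklore] the `u`-member of order zero is `uSl0`. -/
theorem uSlN_zero_eq_uSl0 (α β : ι) : uSlN P M α β 0 = uSl0 A₀ M₀ α β := by
  rw [uSlN_zero_eq, hP0, hM0]; rfl

include hP0 hP1 hM0 hM1 in
/-- [folklore] … of order one is `uSl1`. -/
theorem uSlN_one_eq_uSl1 (α β : ι) : uSlN P M α β 1 = uSl1 A₀ A₁ M₀ M₁ α β := by
  rw [uSlN_one_eq, hP0, hP1, hM0, hM1]; rfl

include hP0 hP1 hP2 hM0 hM1 hM2 in
/-- [folklore] … of order two is `uSl2`. -/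
theorem uSlN_two_eq_uSl2 (α β : ι) : uSlN P M α β 2 = uSl2 A₀ A₁ A₂ M₀ M₁ M₂ α β := by
  rw [uSlN_two_eq, hP0, hP1, hP2, hM0, hM1, hM2]; rfl

include hP0 hP1 hP2 hP3 hM0 hM1 hM2 hM3 in
/-- [folklore] … of order three is `uSl3`. -/
theorem uSlN_three_eq_uSl3 (α β : ι) : uSlN P M α β 3 = uSl3 A₀ A₁ A₂ A₃ M₀ M₁ M₂ M₃ α β := by
  rw [uSlN_three_eq, hP0, hP1, hP2, hP3, hM0, hM1, hM2, hM3]; rfl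

include hP0 hM0 hz0 in
/-- [our object] **BRIDGE, order 0**: `bSlN … 0 = bSl0 A₀ M₀ f α β`. -/
theorem bSlN_zero_eq_bSl0 (α β : ι) (t : ℝ) : bSlN P M z α β 0 t = bSl0 A₀ M₀ f α β t := by
  rw [bSlN, ssN_zero, uSlN_zero_eq_uSl0 hP0 hM0, hz0]; rfl

include hP0 hP1 hM0 hM1 hz0 hz1 in
/-- [our object] **BRIDGE, order 1**: `bSlN … 1 = bSl1 …`. -/
theorem bSlN_one_eq_bSl1 (α β : ι) (t : ℝ) : bSlN P M z α β 1 t = bSl1 A₀ A₁ M₀ M₁ f f₁ α β t := by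
  rw [bSlN, ssN_one, uSlN_zero_eq_uSl0 hP0 hM0, uSlN_one_eq_uSl1 hP0 hP1 hM0 hM1, hz0, hz1]; rfl

include hP0 hP1 hP2 hM0 hM1 hM2 hz0 hz1 hz2 in
/-- [our object] **BRIDGE, order 2**: `bSlN … 2 = bSl2 …`. -/
theorem bSlN_two_eq_bSl2 (α β : ι) (t : ℝ) : bSlN P M z α β 2 t = bSl2 A₀ A₁ A₂ M₀ M₁ M₂ f f₁ f₂ α β t := by
  rw [bSlN, ssN_two, uSlN_zero_eq_uSl0 hP0 hM0, uSlN_one_eq_uSl1 hP0 hP1 hM0 hM1, uSlN_two_eq_uSl2 hP0 hP1 hP2 hM0 hM1 hM2, hz0, hz1, hz2]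
  rfl

include hP0 hP1 hP2 hP3 hM0 hM1 hM2 hM3 hz0 hz1 hz2 hz3 in
/-- [our object] **BRIDGE, order 3**: `bSlN … 3 = bSl3 …`. -/
theorem bSlN_three_eq_bSl3 (α β : ι) (t : ℝ) :
    bSlN P M z α β 3 t = bSl3 A₀ A₁ A₂ A₃ M₀ M₁ M₂ M₃ f f₁ f₂ f₃ α β t := by
  rw [bSlN, ssN_three, uSlN_zero_eq_uSl0 hP0 hM0, uSlN_one_eq_uSl1 hP0 hP1 hM0 hM1, uSlN_two_eq_uSl2 hP0 hP1 hP2 hM0 hM1 hM2,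
    uSlN_three_eq_uSl3 hP0 hP1 hP2 hP3 hM0 hM1 hM2 hM3, hz0, hz1, hz2, hz3]
  rfl

end Bridges

/-! ## §3 The chain at every order -/

section Chain

variable {P M : ℕ → ℝ → Matrix ι ι ℂ} {z : ℕ → ℝ → ℂ} {n : ℕ} {t : ℝ}
  (hP : ∀ j ≤ n, ∀ γ δ, HasDerivAt (fun s => P j s γ δ) (P (j + 1) t γ δ) t)
  (hM : ∀ j ≤ n, ∀ γ δ, HasDerivAt (fun s => M j s γ δ) (M (j + 1) t γ δ) t)
  (hz : ∀ j ≤ n, HasDerivAt (z j) (z (j + 1) t) t)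

include hP hM in
/-- [folklore] the `u`-members form a chain: `(uSlN j)′(t) = uSlN (j+1) t` for `j ≤ n`. -/
theorem hasDerivAt_uSlN (α β : ι) : ∀ j ≤ n, HasDerivAt (uSlN P M α β j) (uSlN P M α β (j + 1) t) t := by
  intro j hj
  have h := hasDerivAt_mmN (n := j) (fun k hk => hP k (hk.trans hj)) (fun k hk => hM k (hk.trans hj)) α β
  exact h

include hP hM hz in
/-- [our object] **THE CHAIN**: `(bSlN P M z α β n)′(t) = bSlN P M z α β (n+1) t`. -/
theorem hasDerivAt_bSlN (α β : ι) : HasDerivAt (bSlN P M z α β n) (bSlN P M z α β (n + 1) t) t := by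
  have h := hasDerivAt_ssN (hasDerivAt_uSlN hP hM α β) hz
  have e : bSlN P M z α β n = fun s => -ssN (uSlN P M α β) z n s := rfl
  rw [e]
  exact h.neg

end Chain

/-! ## §4 Letters at every order -/

section Letters

variable {P M : ℕ → ℝ → Matrix ι ι ℂ} {z : ℕ → ℝ → ℂ} {n : ℕ} {t p m c ρ : ℝ} (hρ : 0 ≤ ρ)
  (bP : ∀ j ≤ n, ∀ γ δ, ‖P j t γ δ‖ ≤ p * ρ ^ j) (bM : ∀ j ≤ n, ∀ γ δ, ‖M j t γ δ‖ ≤ m * ρ ^ j) (bz : ∀ j ≤ n, ‖z j t‖ ≤ c * ρ ^ j)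

include hρ bP bM in
/-- [our object] the `u`-letters: `‖uSlN j t‖ ≤ (card ι · 2^n · p·m) · ρ^j` for `j ≤ n`. -/
theorem norm_uSlN_le (α β : ι) : ∀ j ≤ n, ‖uSlN P M α β j t‖ ≤ (Fintype.card ι * 2 ^ n * (p * m)) * ρ ^ j := by
  intro j hj
  have hp : 0 ≤ p := by simpa using (norm_nonneg _).trans (bP 0 (Nat.zero_le _) α α)
  have hm : 0 ≤ m := by simpa using (norm_nonneg _).trans (bM 0 (Nat.zero_le _) α α)
  have h := norm_mmN_le (n := j) (fun k hk => bP k (hk.trans hj)) (fun k hk => bM k (hk.trans hj)) α β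
  unfold uSlN
  refine h.trans (mul_le_mul_of_nonneg_right ?_ (pow_nonneg hρ j))
  have h2 : (2 : ℝ) ^ j ≤ 2 ^ n := pow_le_pow_right₀ (by norm_num) hj
  exact mul_le_mul_of_nonneg_right (mul_le_mul_of_nonneg_left h2 (Nat.cast_nonneg _)) (mul_nonneg hp hm)

include hρ bP bM bz in
/-- [our object] **LETTERS AT EVERY ORDER**: `‖bSlN P M z α β n t‖ ≤ card ι · 2^n · 2^n · (p·m·c) · ρ^n`. -/
theorem norm_bSlN_le (α β : ι) : ‖bSlN P M z α β n t‖ ≤ Fintype.card ι * 2 ^ n * 2 ^ n * (p * m * c) * ρ ^ n := by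
  have hu := norm_uSlN_le hρ bP bM α β
  have h := norm_ssN_le hρ hu bz
  rw [bSlN, norm_neg]
  refine h.trans (le_of_eq ?_)
  ring

end Letters

end Summit.QuantumFields.BalabanUV.Beta.FP.RemainderSymbolChainN

end
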